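import Summits.CriticalPhenomena.CardyFormulaZ2.Theses.CardyWickAnisotropy
import HarnessLib

/-!
# Stub `stub_walshJets` of line `birth`, crux `CardyWickAnisotropy.AnisotropicBoxCardy`
(stmt-CriticalPhenomena-14309): jets at the self-dual point = twisted Fourier–Walsh level sums

`V n p = Σ_{ω ⊆ E n} 1[ω ∈ LR(R_n)] Π_{e ∈ E n} (w_p e if e ∈ ω else 1 - w_p e)` is the
complex-anisotropy crossing amplitude of the self-dual box `R_n = [0, n+1] × [0, n]`, with weight
`w_p e = p` on horizontal and `1 - p` on vertical bonds; it is a polynomial in `p`. This file proves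
the exact dictionary between its jets at `p = 1/2` and the twisted Fourier–Walsh level sums of the
crossing indicator: for all `n k`,
`iteratedDeriv k (V n) (1/2) = k! · 2^k · W n k`, where
`W n k = Σ_{T ⊆ E n, |T| = k} (−1)^#{vertical bonds of T} · 2^{−|E n|} S_T`
is the level-`k` sum, `S_T = Σ_{ω ⊆ E n} 1[ω ∈ LR] (−1)^|T ∖ ω|` the twisted Walsh coefficient.

Proof: pure finite calculus. Every factor is affine, `1/2 + τ_e(ω) (p − 1/2)` with the sign
`τ_e(ω) = (±1)_{e ∈ ω} (±1)_{e horizontal}` (the four cases `p`, `1 − p`, `1 − p`, `p`). Expanding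
`Π_{e ∈ E n} (1/2 + τ_e(ω) (p − 1/2))` over subsets `T ⊆ E n` (`Finset.prod_add`), using
`Π_{e ∈ T} τ_e(ω) = (−1)^#{e ∈ T vertical} (−1)^|T ∖ ω|` and exchanging the two sums
(`Finset.sum_comm`) writes `V n` as the finite sum of monomials `Σ_{T ⊆ E n} c_T (p − 1/2)^|T|` with
`c_T = 2^|T| (−1)^#{e ∈ T vertical} 2^{−|E n|} Σ_ω 1[ω ∈ LR] (−1)^|T ∖ ω|`; the `k`-th derivative at
`1/2` of `c_T (p − 1/2)^|T|` is `k! c_T` if `|T| = k` and `0` otherwise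
(`iteratedDeriv_fun_sum`, `iteratedDeriv_comp_sub_const`, `iteratedDeriv_fun_pow_zero`), and
`Σ_{T ⊆ E n, |T| = k} = Σ_{T ∈ powersetCard k (E n)}` (`Finset.powersetCard_eq_filter`).
No monotonicity of the crossing event is used: the identity holds for an arbitrary event `A`.
-/

namespace Summit.CriticalPhenomena.CardyFormulaZ2.Theorems

open scoped Classical

universe u

/-! ### Abstract bookkeeping: the two-colour cylinder polynomial around the symmetric point -/

/-- An `if` with else-branch `0` commutes with a finite sum. -/
private theorem ite_sum_else_zero {κ : Type*} (s : Finset κ) (P : Prop) [Decidable P]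
    (g : κ → ℂ) : (if P then ∑ k ∈ s, g k else 0) = ∑ k ∈ s, (if P then g k else 0) := by
  split_ifs <;> simp

/-- The cast `ℝ → ℂ` commutes with `if`. -/
private theorem ofReal_ite (P : Prop) [Decidable P] (a b : ℝ) :
    ((if P then a else b : ℝ) : ℂ) = if P then (a : ℂ) else (b : ℂ) :=
  apply_ite _ _ _ _

/-- A product of signs `±1` is `(-1)^(number of minus signs)`. -/
private theorem prod_ite_one_neg_one {ι : Type u} (T : Finset ι) (P : ι → Prop)
    [DecidablePred P] :
    ∏ e ∈ T, (if P e then (1:ℂ) else -1) = (-1) ^ (T.filter (fun e ↦ ¬ P e)).card := by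
  rw [Finset.prod_ite, Finset.prod_const_one, one_mul, Finset.prod_const]

/-- The `k`-th derivative at `1/2` of the monomial `c · (p - 1/2)^m` is `k! · c` if `m = k` and `0`
otherwise. -/
private theorem iteratedDeriv_const_mul_sub_half_pow (c : ℂ) (m k : ℕ) :
    iteratedDeriv k (fun p : ℂ ↦ c * (p - 1 / 2) ^ m) ((1:ℂ) / 2) =
      if m = k then c * k.factorial else 0 := by
  rw [iteratedDeriv_const_mul_field]
  have h := congrFun (iteratedDeriv_comp_sub_const k (fun x : ℂ ↦ x ^ m) ((1:ℂ) / 2)) ((1:ℂ) / 2)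
  simp only [sub_self] at h
  rw [h, iteratedDeriv_fun_pow_zero]
  by_cases hmk : m = k
  · subst hmk
    simp
  · rw [if_neg hmk, if_neg (fun h ↦ hmk h.symm), Nat.cast_zero, mul_zero]

/-- **Twisted Fourier–Walsh expansion of the two-colour cylinder polynomial.** With
`w p e = p` if `hor e` and `1 - p` otherwise, every factor `(w p e if e ∈ ω else 1 - w p e)` equals
`1/2 + τ_e(ω) (p - 1/2)` with the sign `τ_e(ω) = (±1)_{e ∈ ω} (±1)_{hor e}`; expanding the product
over `K` (`Finset.prod_add`) and exchanging the sums gives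
`Σ_ω 1[ω ∈ A] Π_e (…) = Σ_{T ⊆ K} c_T (p − 1/2)^|T|`,
`c_T = 2^|T| (−1)^#{e ∈ T, ¬hor e} (2^{-|K|} Σ_ω 1[ω ∈ A] (−1)^|T ∖ ω|)`. -/
private theorem twoColourCylinder_eq_sum_powerset {ι : Type u} [DecidableEq ι] (K : Finset ι)
    (A : Set (Set ι)) (hor : ι → Prop) [DecidablePred hor]
    (w : ℂ → ι → ℂ) (hw : ∀ p e, w p e = if hor e then p else 1 - p) (p : ℂ) :
    (∑ ω ∈ K.powerset,
        if (↑ω : Set ι) ∈ A then ∏ e ∈ K, (if e ∈ ω then w p e else 1 - w p e) else 0) =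
      ∑ T ∈ K.powerset, (2 ^ T.card * ((-1) ^ (T.filter (fun e ↦ ¬ hor e)).card *
        ((∑ ω ∈ K.powerset, if (↑ω : Set ι) ∈ A then (-1:ℂ) ^ (T \ ω).card else 0) /
          2 ^ K.card))) * (p - 1 / 2) ^ T.card := by
  -- normal form of the factors: `τ_e(ω) (p - 1/2) + 1/2`
  have hfac : ∀ (ω : Finset ι) (e : ι), (if e ∈ ω then w p e else 1 - w p e) =
      ((if e ∈ ω then (1:ℂ) else -1) * (if hor e then (1:ℂ) else -1)) * (p - 1 / 2) + 1 / 2 := by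
    intro ω e
    rw [hw]
    split_ifs <;> ring
  -- expand the product over `K`
  have hprod : ∀ ω : Finset ι, ∏ e ∈ K, (if e ∈ ω then w p e else 1 - w p e) =
      ∑ T ∈ K.powerset, ((-1:ℂ) ^ (T \ ω).card * (-1) ^ (T.filter (fun e ↦ ¬ hor e)).card *
        (p - 1 / 2) ^ T.card) * (1 / 2) ^ (K \ T).card := by
    intro ω
    rw [Finset.prod_congr rfl (fun e _ ↦ hfac ω e), Finset.prod_add]
    refine Finset.sum_congr rfl fun T _ ↦ ?_
    rw [Finset.prod_const, Finset.prod_mul_distrib, Finset.prod_mul_distrib, Finset.prod_const,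
      prod_ite_one_neg_one, prod_ite_one_neg_one, Finset.sdiff_eq_filter T ω]
  calc (∑ ω ∈ K.powerset,
        if (↑ω : Set ι) ∈ A then ∏ e ∈ K, (if e ∈ ω then w p e else 1 - w p e) else 0)
      = ∑ ω ∈ K.powerset, ∑ T ∈ K.powerset, (if (↑ω : Set ι) ∈ A then
          ((-1:ℂ) ^ (T \ ω).card * (-1) ^ (T.filter (fun e ↦ ¬ hor e)).card *
            (p - 1 / 2) ^ T.card) * (1 / 2) ^ (K \ T).card else 0) := by
        refine Finset.sum_congr rfl fun ω _ ↦ ?_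
        rw [hprod ω, ite_sum_else_zero]
    _ = ∑ T ∈ K.powerset, ∑ ω ∈ K.powerset, (if (↑ω : Set ι) ∈ A then
          ((-1:ℂ) ^ (T \ ω).card * (-1) ^ (T.filter (fun e ↦ ¬ hor e)).card *
            (p - 1 / 2) ^ T.card) * (1 / 2) ^ (K \ T).card else 0) := Finset.sum_comm
    _ = _ := by
        refine Finset.sum_congr rfl fun T hT ↦ ?_
        have hTK : T ⊆ K := Finset.mem_powerset.1 hT
        have hcard : (K \ T).card + T.card = K.card := Finset.card_sdiff_add_card_eq_card hTK
        simp only [Finset.sum_div, Finset.mul_sum, Finset.sum_mul]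
        refine Finset.sum_congr rfl fun ω _ ↦ ?_
        rw [← hcard, pow_add, one_div_pow]
        split_ifs
        · field_simp
        · simp

/-- **Jets at the symmetric point = twisted Fourier–Walsh level sums** (abstract form). For
`V p = Σ_{ω ⊆ K} 1[ω ∈ A] Π_{e ∈ K} (w p e if e ∈ ω else 1 - w p e)` with `w p e = p` if `hor e`,
`1 - p` otherwise, and every `k`,
`iteratedDeriv k V (1/2) = k! · 2^k · Σ_{T ⊆ K, |T| = k} (−1)^#{e ∈ T : ¬hor e} ·
(2^{−|K|} Σ_{ω ⊆ K} 1[ω ∈ A] (−1)^|T ∖ ω|)`: by `twoColourCylinder_eq_sum_powerset`, `V` is a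
finite sum of monomials `c_T (p − 1/2)^|T|`, differentiated term by term
(`iteratedDeriv_const_mul_sub_half_pow`). -/
private theorem iteratedDeriv_twoColourCylinder_half {ι : Type u} [DecidableEq ι] (K : Finset ι)
    (A : Set (Set ι)) (hor : ι → Prop) [DecidablePred hor]
    (w : ℂ → ι → ℂ) (hw : ∀ p e, w p e = if hor e then p else 1 - p)
    (V : ℂ → ℂ) (hV : ∀ p, V p = ∑ ω ∈ K.powerset,
      if (↑ω : Set ι) ∈ A then ∏ e ∈ K, (if e ∈ ω then w p e else 1 - w p e) else 0) (k : ℕ) :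
    iteratedDeriv k V ((1:ℂ) / 2) =
      (((k.factorial : ℝ) * 2 ^ k * (∑ T ∈ K.powersetCard k,
        (-1 : ℝ) ^ (T.filter (fun e ↦ ¬ hor e)).card *
          ((∑ ω ∈ K.powerset, (if (↑ω : Set ι) ∈ A then (-1 : ℝ) ^ (T \ ω).card else 0)) /
            (2 : ℝ) ^ K.card)) : ℝ) : ℂ) := by
  have hVfun : V = fun p ↦ ∑ T ∈ K.powerset, (2 ^ T.card *
      ((-1) ^ (T.filter (fun e ↦ ¬ hor e)).card *
        ((∑ ω ∈ K.powerset, if (↑ω : Set ι) ∈ A then (-1:ℂ) ^ (T \ ω).card else 0) /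
          2 ^ K.card))) * (p - 1 / 2) ^ T.card := by
    funext p
    rw [hV p]
    exact twoColourCylinder_eq_sum_powerset K A hor w hw p
  rw [hVfun, iteratedDeriv_fun_sum (fun T _ ↦ by fun_prop)]
  simp only [iteratedDeriv_const_mul_sub_half_pow]
  rw [← Finset.sum_filter, ← Finset.powersetCard_eq_filter]
  push_cast [ofReal_ite]
  rw [Finset.mul_sum]
  refine Finset.sum_congr rfl fun T hT ↦ ?_
  rw [(Finset.mem_powersetCard.1 hT).2]
  ring

/-! ### The stub -/

/-- **Stub `stub_walshJets`** (line `birth` of crux `AnisotropicBoxCardy`): the jets of the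
complex-anisotropy crossing amplitude `V n` of the box `[0, n+1] × [0, n]` at the self-dual point
`p = 1/2` are the twisted Fourier–Walsh level sums of the crossing indicator,
`iteratedDeriv k (V n) (1/2) = k! · 2^k · W n k`; exact for all `n k`. -/
theorem stub_walshJets :
    let E : ℕ → Finset (Sym2 (Literature.Probability.LatticeModels.Site 2)) := fun n ↦ ((Literature.Probability.Percolation.rectangle (n + 1) n ×ˢ Literature.Probability.Percolation.rectangle (n + 1) n).filter (fun xy ↦ (Literature.Probability.LatticeModels.zdGraph 2).Adj xy.1 xy.2)).image (fun xy ↦ s(xy.1, xy.2)); let w : ℂ → Sym2 (Literature.Probability.LatticeModels.Site 2) → ℂ := fun p e ↦ if (∃ x y : Literature.Probability.LatticeModels.Site 2, e = s(x, y) ∧ x 1 = y 1) then p else 1 - p; let V : ℕ → ℂ → ℂ := fun n p ↦ ∑ ω ∈ (E n).powerset, (if ((ω : Set (Sym2 (Literature.Probability.LatticeModels.Site 2))) ∈ Literature.Probability.Percolation.lrCrossing (n + 1) n) then ∏ e ∈ E n, (if e ∈ ω then w p e else 1 - w p e) else 0); let W : ℕ → ℕ → ℝ := fun n k ↦ ∑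 T ∈ (E n).powersetCard k, (-1 : ℝ) ^ (T.filter (fun e ↦ ¬ ∃ x y : Literature.Probability.LatticeModels.Site 2, e = s(x, y) ∧ x 1 = y 1)).card * ((∑ ω ∈ (E n).powerset, (if ((ω : Set (Sym2 (Literature.Probability.LatticeModels.Site 2))) ∈ Literature.Probability.Percolation.lrCrossing (n + 1) n) then (-1 : ℝ) ^ (T \ ω).card else 0)) / (2 : ℝ) ^ (E n).card); ∀ n k : ℕ, iteratedDeriv k (V n) ((1:ℂ) / 2) = (((k.factorial : ℝ) * 2 ^ k * W n k : ℝ) : ℂ) := by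
  intro E w V W n k
  exact iteratedDeriv_twoColourCylinder_half (E n)
    (Literature.Probability.Percolation.lrCrossing (n + 1) n)
    (fun e ↦ ∃ x y : Literature.Probability.LatticeModels.Site 2, e = s(x, y) ∧ x 1 = y 1)
    w (fun _ _ ↦ rfl) (V n) (fun _ ↦ rfl) k

end Summit.CriticalPhenomena.CardyFormulaZ2.Theorems
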